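import Literature.NumberTheory.GaloisRepresentations.TateDualLimitSelmerTorsionFree
import Literature.NumberTheory.GaloisRepresentations.PontryaginTateDualInverseLimitEquivariance
import Literature.NumberTheory.IwasawaTheory.Greenberg2016.RestrictedRamificationBridge
import Literature.NumberTheory.GaloisRepresentations.BlochKatoSelmerGroup
import HarnessLib

/-!
# Greenberg's `S_{𝓛*}(K, T*)` and `Ш¹(K, Σ, T*)` for the compact dual `T* = lim_k Hom(𝐃[𝔪ᵏ], μ_{p^k})`,
# and the scalars `θ̂_r` (`r ∈ Λ`) on `T*` — the objects of the assembly of Greenberg 2010 Prop. 3.2.1 (c)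

Topic `NumberTheory/IwasawaTheory/Greenberg2016`; namespace
`Literature.NumberTheory.IwasawaTheory.Greenberg2016`. Definitions WITH BODIES and theorems; no named
fact, no `sorry`, no instance, no notation. Seat `bsd-line-x1-p1-w4` gen 18 (prover, width seat of cell
`bsd-eis`), brick C7-skeleton (objects) of the road memo «SUR-Λ» (crux `GoodLatticeBDPValue`,
stmt-BirchSwinnertonDyer-19032; target `prop263_sur_of_crk_caseC_tc`).

PRINT (R. Greenberg, Kyoto J. Math. 50 (2010)). §3.1 p. 14: "`G(K, T*)`, `P(K, T*)` and `L(K, T*)` will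
be denoted by `G*`, `P*`, and `L*` … `G*∩L*` is the image of `S_{L*}(K, T*)` under the second map in (10).
Denoting the kernel of that map by `Ш¹(K, Σ, T*)` …"; §2 p. 6 L5–8: the `Λ`-module structure of
`T* = Hom(D, μ_{p^∞})`. In the tree's currency (`𝐃`, `ρ`, `𝓛` of `SelmerGroupStructure.lean`;
`T* := (torsionLayers ρ e hD).dualSystem.limitRep` of `CompactTateDual.lean`; the `Λ`-adic local pairing
`limitPairing` / `dualLocalCondition` of `TateDualLimitLocalPairing.lean` for a family
`inv : ∀ k, LocalInvariants K (p^k)` of local invariant maps; the localisation `locDual` of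
`TateDualLimitSelmerTorsionFree.lean`; the `Γ_K`/`G_S` bridge `localHAddEquiv` of
`RestrictedRamificationBridge.lean`):

* `scalarDualEndHom ρ e hD r : T* ⟶ T*` — the scalar `r ∈ Λ` on `T*` as a `TopRep` endomorphism
  (`θ̂_r = TorsionLayers.dualEndHom` of `d ↦ r·d`; `_hom_apply`: `(θ̂_r x)(d) = x(r·d)`); the class-level
  scalar is `cohomologyMap (scalarDualEndHom ρ e hD r) 1`;
* `localConditionGal L v ≤ H¹(Γ_{K_v}, 𝐃)` — Greenberg's `L(K_v, 𝐃)` read on the `Γ_K`-side through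
  `localHAddEquiv` (`mem_localConditionGal_iff`);
* **`dualSelmer ρ e hD inv L`** = `S_{𝓛*}(K, T*)`: the classes `y ∈ H¹_cont(Γ_K, T*)` with
  `loc_v y ∈ L(K_v, 𝐃)^⊥` at the places of `Σ` and `loc_w y ∈ H¹_ur(K_w, 𝐃)^⊥` at the finite `w ∉ S`
  ("unramified outside `Σ`", the image of `H¹(K_Σ/K, T*)`);
* **`dualSha ρ e hD inv`** = `Ш¹(K, Σ, T*)`: `loc_v y = 0` at the places of `Σ`, unramified off `S`;
  `dualSha_le_dualSelmer`, membership lemmas.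

HONESTY. Objects only (plus unfolding lemmas); nothing here proves Prop. 3.2.1, SUR, or any summit
statement; BSD is not advanced. AI-typed, kernel-checked.

## References
* R. Greenberg, *Surjectivity of the global-to-local map defining a Selmer group*, Kyoto J. Math. 50
  (2010) 853–888, §2 p. 6 L5–8, §2.1 p. 7 L10–14 (`Ш¹(K, Σ, T*)`), §3.1 p. 14 L13–26 (`S_{L*}(K, T*)`).
  [Greenberg2010]
-/

noncomputable section

open scoped Classical
open Function CategoryTheory NumberField IsDedekindDomain Field IsLocalRing
open _root_.TopRep _root_.ContRepresentation _root_.ContinuousCohomology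
open Literature.NumberTheory.GaloisRepresentations
open Literature.NumberTheory.GaloisRepresentations.DiscreteGaloisModule
open Literature.NumberTheory.IwasawaTheory.Greenberg2006
open Literature.NumberTheory.GaloisCohomology (LocalInvariants)

namespace Literature.NumberTheory.IwasawaTheory.Greenberg2016

variable {K : Type} [Field K] [NumberField K] {S : Set (HeightOneSpectrum (𝓞 K))}
  {Λ : Type} [CommRing Λ] [TopologicalSpace Λ] [IsTopologicalRing Λ]
  {D : Type} [AddCommGroup D] [Module Λ D] [TopologicalSpace D] [DiscreteTopology D]
  [ContinuousSMul Λ D]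
  (ρ : ContinuousRep (GaloisGroupUnramifiedOutside K S) Λ D)
  {p : ℕ} [Fact p.Prime] {m : ℕ} [IsLocalRing Λ]
  (e : Λ ≃+* MvPowerSeries (Fin m) ℤ_[p]) (hD : IsCofinitelyGenerated Λ D)

/-! ### The scalars `θ̂_r` on `T*` -/

omit [NumberField K] [IsTopologicalRing Λ] [ContinuousSMul Λ D] [IsLocalRing Λ] in
/-- The scalar `r` commutes with `Γ_K` on `𝐃` (in the orientation `hθτ` of `TorsionLayers.dualEndHom`).
[cite: Greenberg2010, §2 p. 6 L5–8] -/
theorem smul_toDiscreteGaloisModule_comm (r : Λ) (σ : absoluteGaloisGroup K) (d : D) :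
    DistribSMul.toAddMonoidHom D r (toDiscreteGaloisModule ρ σ d) =
      toDiscreteGaloisModule ρ σ (DistribSMul.toAddMonoidHom D r d) :=
  (toDiscreteGaloisModule_smul ρ σ r d).symm

/-- **The scalar `r ∈ Λ` on `T* = lim_k Hom(𝐃[𝔪ᵏ], μ_{p^k})` as an endomorphism of the topological
`Γ_K`-representation** (`θ̂_r`, `(θ̂_r x)(d) = x(r·d)`); `H¹(θ̂_r) = cohomologyMap (scalarDualEndHom … r) 1`
is the action of `r` on `H¹_cont(Γ_K, T*)`. [cite: Greenberg2010, §2 p. 6 L5–8, (7) p. 7] -/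
def scalarDualEndHom (r : Λ) :
    (torsionLayers ρ e hD).dualSystem.limitRep.toTopRep ⟶
      (torsionLayers ρ e hD).dualSystem.limitRep.toTopRep :=
  (torsionLayers ρ e hD).dualEndHom (DistribSMul.toAddMonoidHom D r)
    (fun k d hd => smul_mem_torsionLayers ρ e hD k r d hd) (smul_toDiscreteGaloisModule_comm ρ r)

omit [NumberField K] [IsTopologicalRing Λ] [ContinuousSMul Λ D] in
/-- Unfolding `scalarDualEndHom` on elements. [cite: Greenberg2010, §2 p. 6 L5–8] -/
@[simp] theorem scalarDualEndHom_hom_apply (r : Λ) (x : (torsionLayers ρ e hD).dualSystem.limit) :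
    (scalarDualEndHom ρ e hD r).hom x =
      (torsionLayers ρ e hD).dualEnd (DistribSMul.toAddMonoidHom D r)
        (fun k d hd => smul_mem_torsionLayers ρ e hD k r d hd) x := rfl

omit [NumberField K] [IsTopologicalRing Λ] [ContinuousSMul Λ D] in
/-- `(θ̂_r x)(d) = x(r·d)`. [cite: Greenberg2010, §2 p. 6 L5–8] -/
theorem evalDual_scalarDualEndHom (r : Λ) (x : (torsionLayers ρ e hD).dualSystem.limit) (d : D) :
    (torsionLayers ρ e hD).evalDual ((scalarDualEndHom ρ e hD r).hom x) d =
      (torsionLayers ρ e hD).evalDual x (r • d) :=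
  (torsionLayers ρ e hD).evalDual_dualEnd _ _ x d

omit [NumberField K] [IsTopologicalRing Λ] [ContinuousSMul Λ D] in
/-- **`θ̂_s ∘ θ̂_r = θ̂_{r s}`** on elements of `T*`. [cite: Greenberg2010, §2 p. 6 L5–8] -/
theorem scalarDualEndHom_comp_apply (r s : Λ) (x : (torsionLayers ρ e hD).dualSystem.limit) :
    (scalarDualEndHom ρ e hD s).hom ((scalarDualEndHom ρ e hD r).hom x) =
      (scalarDualEndHom ρ e hD (r * s)).hom x := by
  apply (torsionLayers ρ e hD).evalDual_injective
  ext d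
  rw [evalDual_scalarDualEndHom, evalDual_scalarDualEndHom, evalDual_scalarDualEndHom, mul_smul]

omit [NumberField K] [IsTopologicalRing Λ] [ContinuousSMul Λ D] in
/-- **`H¹(θ̂_s) ∘ H¹(θ̂_r) = H¹(θ̂_{r s})`** on `Hⁿ_cont(Γ_K, T*)`. [cite: Greenberg2010, §2 p. 6 L5–8, (7) p. 7] -/
theorem cohomologyMap_scalarDualEndHom_comp (r s : Λ) (n : ℕ)
    (y : continuousCohomology n (torsionLayers ρ e hD).dualSystem.limitRep.toTopRep) :
    cohomologyMap (scalarDualEndHom ρ e hD s) n (cohomologyMap (scalarDualEndHom ρ e hD r) n y) =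
      cohomologyMap (scalarDualEndHom ρ e hD (r * s)) n y :=
  cohomologyMap_comp_apply_of_eq _ _ _ (scalarDualEndHom_comp_apply ρ e hD r s) n y

omit [NumberField K] [IsTopologicalRing Λ] [ContinuousSMul Λ D] in
/-- **`θ̂_r` is injective on `T*` when `r` acts surjectively on `𝐃`** ("`D` divisible ⟹ `T*`
torsion-free"). [cite: Greenberg2010, Prop. 2.1.1 proof (p. 7 L28)] -/
theorem scalarDualEndHom_injective_of_surjective (r : Λ) (hr : Surjective fun d : D => r • d) :
    Injective (scalarDualEndHom ρ e hD r).hom :=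
  (torsionLayers ρ e hD).dualEnd_injective_of_surjective _ _ hr

/-! ### Greenberg's local conditions on the `Γ_K`-side -/

/-- **`L(K_v, 𝐃)` on the `Γ_K`-side**: the preimage of Greenberg's `L v ≤ H¹(K_v, 𝐃)` (dictionary
`Specification`) under the bridge `localHAddEquiv S ρ v 1 : H¹(Γ_{K_v}, 𝐃) ≃+ H¹(K_v, 𝐃)`.
[cite: Greenberg2010, §1 p. 3 L19–21] -/
def localConditionGal (L : Specification S ρ) (v : Place K) :
    AddSubgroup (galoisCohomology ((toGaloisModule S ρ).toLocal v) 1) :=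
  (L v).toAddSubgroup.comap (localHAddEquiv S ρ v 1).toAddMonoidHom

omit [IsTopologicalRing Λ] [IsLocalRing Λ] in
/-- Membership in `localConditionGal`. [cite: Greenberg2010, §1 p. 3 L19–21] -/
@[simp] theorem mem_localConditionGal_iff (L : Specification S ρ) (v : Place K)
    (t : galoisCohomology ((toGaloisModule S ρ).toLocal v) 1) :
    t ∈ localConditionGal ρ L v ↔ localHAddEquiv S ρ v 1 t ∈ L v := Iff.rfl

/-! ### `S_{𝓛*}(K, T*)` and `Ш¹(K, Σ, T*)` -/

variable (inv : ∀ k : ℕ, LocalInvariants K (p ^ k))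

/-- **`S_{𝓛*}(K, T*)`** — the `𝓛*`-Selmer classes of the compact dual: `y ∈ H¹_cont(Γ_K, T*)` with
`loc_v y ∈ L(K_v, 𝐃)^⊥` for `v ∈ Σ` (all archimedean places and the finite places of `S`) and
`loc_w y ∈ H¹_ur(K_w, 𝐃)^⊥` for the finite `w ∉ S` (the classes of `H¹(K_Σ/K, T*)`), the orthogonal
complements `(·)^⊥ = dualLocalCondition` being taken for the `Λ`-adic local pairing of the family `inv`.
[cite: Greenberg2010, §3.1 p. 14 L13–26, §1 p. 3] -/
def dualSelmer (L : Specification S ρ) :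
    AddSubgroup (continuousCohomology 1 (torsionLayers ρ e hD).dualSystem.limitRep.toTopRep) where
  carrier := {y |
    (∀ v : Place K, InSigma S v →
      (torsionLayers ρ e hD).locDual (absGaloisRestrict K (Place.Completion v)) y ∈
        (torsionLayers ρ e hD).dualLocalCondition inv v (localConditionGal ρ L v)) ∧
    ∀ w : HeightOneSpectrum (𝓞 K), w ∉ S →
      (torsionLayers ρ e hD).locDual (absGaloisRestrict K (Place.Completion (Sum.inr w : Place K))) y ∈
        (torsionLayers ρ e hD).dualLocalCondition inv (Sum.inr w)
          (unramifiedSubgroup (GaloisRep.toLocal w (toGaloisModule S ρ)) 1)}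
  zero_mem' := ⟨fun v _ => by rw [map_zero]; exact AddSubgroup.zero_mem _,
    fun w _ => by rw [map_zero]; exact AddSubgroup.zero_mem _⟩
  add_mem' := fun {a b} ha hb =>
    ⟨fun v hv => by rw [map_add]; exact AddSubgroup.add_mem _ (ha.1 v hv) (hb.1 v hv),
      fun w hw => by rw [map_add]; exact AddSubgroup.add_mem _ (ha.2 w hw) (hb.2 w hw)⟩
  neg_mem' := fun {a} ha =>
    ⟨fun v hv => by rw [map_neg]; exact AddSubgroup.neg_mem _ (ha.1 v hv),
      fun w hw => by rw [map_neg]; exact AddSubgroup.neg_mem _ (ha.2 w hw)⟩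

omit [IsTopologicalRing Λ] in
/-- Membership in `S_{𝓛*}(K, T*)`. [cite: Greenberg2010, §3.1 p. 14 L13–26] -/
theorem mem_dualSelmer_iff (L : Specification S ρ)
    (y : continuousCohomology 1 (torsionLayers ρ e hD).dualSystem.limitRep.toTopRep) :
    y ∈ dualSelmer ρ e hD inv L ↔
      (∀ v : Place K, InSigma S v →
        (torsionLayers ρ e hD).locDual (absGaloisRestrict K (Place.Completion v)) y ∈
          (torsionLayers ρ e hD).dualLocalCondition inv v (localConditionGal ρ L v)) ∧
      ∀ w : HeightOneSpectrum (𝓞 K), w ∉ S →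
        (torsionLayers ρ e hD).locDual (absGaloisRestrict K (Place.Completion (Sum.inr w : Place K))) y ∈
          (torsionLayers ρ e hD).dualLocalCondition inv (Sum.inr w)
            (unramifiedSubgroup (GaloisRep.toLocal w (toGaloisModule S ρ)) 1) :=
  Iff.rfl

/-- **`Ш¹(K, Σ, T*)`** — the classes of `H¹(K_Σ/K, T*)` (unramified off `S`, as in `dualSelmer`) whose
localisation VANISHES at every place of `Σ` ("the kernel of `H¹(K_Σ/K, T*) → P(K, T*)`").
[cite: Greenberg2010, §2.1 p. 7 L10–14, §3.1 p. 14 L24–26] -/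
def dualSha : AddSubgroup (continuousCohomology 1 (torsionLayers ρ e hD).dualSystem.limitRep.toTopRep) where
  carrier := {y |
    (∀ v : Place K, InSigma S v →
      (torsionLayers ρ e hD).locDual (absGaloisRestrict K (Place.Completion v)) y = 0) ∧
    ∀ w : HeightOneSpectrum (𝓞 K), w ∉ S →
      (torsionLayers ρ e hD).locDual (absGaloisRestrict K (Place.Completion (Sum.inr w : Place K))) y ∈
        (torsionLayers ρ e hD).dualLocalCondition inv (Sum.inr w)
          (unramifiedSubgroup (GaloisRep.toLocal w (toGaloisModule S ρ)) 1)}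
  zero_mem' := ⟨fun v _ => map_zero _, fun w _ => by rw [map_zero]; exact AddSubgroup.zero_mem _⟩
  add_mem' := fun {a b} ha hb =>
    ⟨fun v hv => by rw [map_add, ha.1 v hv, hb.1 v hv, add_zero],
      fun w hw => by rw [map_add]; exact AddSubgroup.add_mem _ (ha.2 w hw) (hb.2 w hw)⟩
  neg_mem' := fun {a} ha =>
    ⟨fun v hv => by rw [map_neg, ha.1 v hv, neg_zero],
      fun w hw => by rw [map_neg]; exact AddSubgroup.neg_mem _ (ha.2 w hw)⟩

omit [IsTopologicalRing Λ] [ContinuousSMul Λ D] in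
/-- Membership in `Ш¹(K, Σ, T*)`. [cite: Greenberg2010, §2.1 p. 7 L10–14] -/
theorem mem_dualSha_iff (y : continuousCohomology 1 (torsionLayers ρ e hD).dualSystem.limitRep.toTopRep) :
    y ∈ dualSha ρ e hD inv ↔
      (∀ v : Place K, InSigma S v →
        (torsionLayers ρ e hD).locDual (absGaloisRestrict K (Place.Completion v)) y = 0) ∧
      ∀ w : HeightOneSpectrum (𝓞 K), w ∉ S →
        (torsionLayers ρ e hD).locDual (absGaloisRestrict K (Place.Completion (Sum.inr w : Place K))) y ∈
          (torsionLayers ρ e hD).dualLocalCondition inv (Sum.inr w)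
            (unramifiedSubgroup (GaloisRep.toLocal w (toGaloisModule S ρ)) 1) :=
  Iff.rfl

omit [IsTopologicalRing Λ] in
/-- **`Ш¹(K, Σ, T*) ≤ S_{𝓛*}(K, T*)`** for every specification `𝓛`. [cite: Greenberg2010, §3.1 p. 14 L24–26] -/
theorem dualSha_le_dualSelmer (L : Specification S ρ) : dualSha ρ e hD inv ≤ dualSelmer ρ e hD inv L :=
  fun _ hy => ⟨fun v hv => by rw [hy.1 v hv]; exact AddSubgroup.zero_mem _, hy.2⟩

end Literature.NumberTheory.IwasawaTheory.Greenberg2016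

end
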